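import Summits.CriticalPhenomena.SAWScalingLimit.Theorems.SAWDevelopingMapHexConjectureMarginalWedgeDefs
import Summits.CriticalPhenomena.SAWScalingLimit.Theses.SAWDevelopingMap
import Summits.CriticalPhenomena.SAWScalingLimit.Theorems.ObservableToSLE.Negative.Identification
import Summits.CriticalPhenomena.SAWScalingLimit.Theorems.SAWLeftRightFKGTraversalBoundTight
import Summits.CriticalPhenomena.SAWScalingLimit.Theorems.SAWDefectDecoherenceDefectDecoherenceTmStarSums
import Literature.Probability.RandomPlanarGeometry.HexDomainSingleton
import Literature.Probability.RandomPlanarGeometry.CurveTightness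
import Literature.Probability.Percolation.InterfaceScalingLimitProofs

/-!
# `HexTraversalBound → HexTight` (stub `stub_hexTight_of_traversalBound` of the line
`marginal-reflex-wedge-cauchy-kernel`, crux `HexConjecture`, stmt-CriticalPhenomena-0808)

Crux `Summit.CriticalPhenomena.SAWScalingLimit.Theses.SAWDevelopingMap.HexConjecture`
(Duminil-Copin–Smirnov 2012, Conjecture 1), line `marginal-reflex-wedge-cauchy-kernel`, registered
stub 5: the Aizenman–Burchard multi-traversal bound for the critical hexagonal SAW law
(`HexTraversalBound`, the conclusion of stub 4, taken here as the HYPOTHESIS) implies the route item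
`…Theses.SAWDevelopingMap.HexTight` (eventual tightness `IsTightAlongMesh` of the laws `hexSAWLaw`
pushed to `CurveClass ℂ`).

**Proof** — the tree's PROVED Aizenman–Burchard criterion `isTightMeasureSet_of_traversalBounds`
(`Literature/…/CurveTightness.lean`, AB99 Thms 1.1–1.2), declaration by declaration as for the
`δℤ²` SAW (`Theorems/SAWLeftRightFKGTraversalBoundTight.lean`, whose generic polyline lemmas
`segMeetCount_map_le_card_of_chain`, `range_toCurve_subset_of_convex` are reused) and the spin-Ising
interfaces (`Literature/…/InterfaceSLETightness.lean`):
* container `Λ = B̄(0, r_Λ)`, `r_Λ = max r 0 + ‖a‖ + 1` with `D ⊆ B̄(0, r)` (`JordanDomain.isBounded`)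
  and `a = D.pt 0`; covering exponent `d = 2` (`exists_finset_card_le_cover_closedBall`);
* random curves `X_δ γ = hexPolyline γ`, the polyline of the SAW through the rescaled face centres,
  whose class is `γ.curve` definitionally (`mk_hexPolyline`);
* index set `T = (0, δ₁]`, `δ₁ = min (min δ₀ (δ₂/2)) 1`, where `δ · c_{a δ} ∈ B(a, 1)` for
  `0 < δ < δ₂` (`IsEmbEndpointApprox.tendsto_fst`; this only matters for the trivial walk
  `a δ = b δ`, whose single vertex need not lie in `Ω_δ`);
* threshold `max 487 (k x ρ R)`;
* (H0): every vertex of a SAW of `Ω_δ` after the first lies in `Ω_δ` hence in `D`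
  (`mem_embMeshDomain_of_mem_support_tail`), so the polyline stays in `Λ`
  (`range_toCurve_subset_of_convex`); and the SHORT-DISTANCE CUTOFF `not_hasTraversals_hexPolyline`:
  at mesh `δ` no self-avoiding honeycomb polyline traverses a shell of inner radius `ρ ≤ δ` by
  `487 = 2 · (242 + 1) + 1` separate segments — an edge whose rescaled segment meets `B̄(x, ρ)`
  starts within `2δ` of `x` (adjacent centres are `1/√3 ≤ 1` apart, `dist_hexCenter_le_one_of_adj`
  of `Theorems/SAWDefectDecoherenceDefectDecoherenceTmStarSums.lean`), all such start vertices lie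
  in the box of `2 · 11² = 242` faces about any one of them (`abs_sub_le_of_norm_hexCenter_sub_le`,
  `mem_faceBox`, `card_faceBox_le`), a path repeats no vertex, so the times in the ball are covered
  by `≤ 243` order-connected pieces carrying two traversals each
  (`Percolation.hasOrdConnectedCover_preimage_polylineFrom`,
  `Percolation.le_of_hasTraversals_of_hasOrdConnectedCover`);
* (H1) is the hypothesis, weakened in the threshold (`Curve.HasTraversals.of_le`);
* finally `isTightAlongMesh_of_isTightMeasureSet_image` (a.e.-measurability is free on the discrete
  σ-algebra, `EmbDomainSAW.measurable_of_top`).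

No named fact is used. References: M. Aizenman, A. Burchard, Duke Math. J. 99 (1999) 419–453,
Thms 1.1–1.2 and §1.a (short-distance cutoff) [AizenmanBurchardDuke1999]; H. Duminil-Copin,
S. Smirnov, Ann. of Math. 175 (2012), §4 Conjecture 1 [DuminilCopinSmirnov2012].
-/

noncomputable section

open scoped BigOperators Classical
open MeasureTheory Filter Topology Set Metric
open Literature.Probability.LatticeModels Literature.Probability.RandomPlanarGeometry
  Literature.Probability.RandomPlanarGeometry.SAW
open Literature.Probability.Percolation (segMeetCount hasOrdConnectedCover_preimage_polylineFrom
  le_of_hasTraversals_of_hasOrdConnectedCover)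
open Summit.CriticalPhenomena.SAWScalingLimit.Theorems.ObservableToSLE.Negative
  (mem_embMeshDomain_of_mem_support_tail)
open Summit.CriticalPhenomena.SAWScalingLimit.Theorems.DefectDecoherence.TipMartingale
  (dist_hexCenter_le_one_of_adj)

namespace Summit.CriticalPhenomena.SAWScalingLimit.Theorems.HexConjecture.MarginalWedge

namespace Tight

/-! ### Lattice bookkeeping: coordinates and the box of faces near a face -/

/-- **Cells are controlled by the distance of the centres**: two faces whose centres are within
`4` of each other have cell coordinates within `5` of each other (on writing the difference of the
centres as `a + b ζ`, `|a + b ζ|² = a² + ab + b² ≥ 3b²/4, 3a²/4`). [folklore] -/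
theorem abs_sub_le_of_norm_hexCenter_sub_le {F G : HexVertex}
    (h : ‖hexCenter F - hexCenter G‖ ≤ 4) : |F.1 0 - G.1 0| ≤ 5 ∧ |F.1 1 - G.1 1| ≤ 5 := by
  obtain ⟨p, k⟩ := F
  obtain ⟨q, l⟩ := G
  have hsq : Complex.normSq (hexCenter (p, k) - hexCenter (q, l)) ≤ 16 := by
    rw [Complex.normSq_eq_norm_sq]
    nlinarith [norm_nonneg (hexCenter (p, k) - hexCenter (q, l))]
  rw [hexCenter_sub_hexCenter, normSq_add_mul_triZeta] at hsq
  have hk : ((k : ℕ) : ℝ) ≤ 1 := by exact_mod_cast Nat.lt_succ_iff.1 k.is_lt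
  have hl : ((l : ℕ) : ℝ) ≤ 1 := by exact_mod_cast Nat.lt_succ_iff.1 l.is_lt
  have hk0 : (0 : ℝ) ≤ ((k : ℕ) : ℝ) := Nat.cast_nonneg _
  have hl0 : (0 : ℝ) ≤ ((l : ℕ) : ℝ) := Nat.cast_nonneg _
  set e : ℝ := (((k : ℕ) : ℝ) - ((l : ℕ) : ℝ)) / 3 with he
  set A : ℝ := ((p 0 - q 0 : ℤ) : ℝ) with hA
  set B : ℝ := ((p 1 - q 1 : ℤ) : ℝ) with hB
  have he1 : -1 / 3 ≤ e := by rw [he]; linarith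
  have he2 : e ≤ 1 / 3 := by rw [he]; linarith
  have hB2 : 3 * (B + e) ^ 2 ≤ 64 := by nlinarith [sq_nonneg (2 * (A + e) + (B + e))]
  have hA2 : 3 * (A + e) ^ 2 ≤ 64 := by nlinarith [sq_nonneg ((A + e) + 2 * (B + e))]
  have hB5 : B + e < 5 := by nlinarith
  have hB5' : -5 < B + e := by nlinarith
  have hA5 : A + e < 5 := by nlinarith
  have hA5' : -5 < A + e := by nlinarith
  have h0 : ((p 0 - q 0 : ℤ) : ℝ) < 6 := by linarith
  have h0' : (-6 : ℝ) < ((p 0 - q 0 : ℤ) : ℝ) := by linarith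
  have h1 : ((p 1 - q 1 : ℤ) : ℝ) < 6 := by linarith
  have h1' : (-6 : ℝ) < ((p 1 - q 1 : ℤ) : ℝ) := by linarith
  have i0 : p 0 - q 0 < 6 := by exact_mod_cast h0
  have i0' : -6 < p 0 - q 0 := by exact_mod_cast h0'
  have i1 : p 1 - q 1 < 6 := by exact_mod_cast h1
  have i1' : -6 < p 1 - q 1 := by exact_mod_cast h1'
  change |p 0 - q 0| ≤ 5 ∧ |p 1 - q 1| ≤ 5
  rw [abs_le, abs_le]
  omega

/-- The box of faces whose cell is coordinatewise within `5` of the site `c` (both types) has at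
most `2 · 11² = 242` elements. (Counting device for the short-distance cutoff, AB99 §1.a.)
[folklore] -/
theorem card_faceBox_le (c : Site 2) :
    (((Finset.Icc (c 0 - 5) (c 0 + 5) ×ˢ Finset.Icc (c 1 - 5) (c 1 + 5)) ×ˢ
      (Finset.univ : Finset (Fin 2))).image
        (fun q : (ℤ × ℤ) × Fin 2 => (((![q.1.1, q.1.2] : Site 2), q.2) : HexVertex))).card ≤ 242 := by
  refine Finset.card_image_le.trans ?_
  have h0 : (c 0 + 5 + 1 - (c 0 - 5)).toNat = 11 := by omega
  have h1 : (c 1 + 5 + 1 - (c 1 - 5)).toNat = 11 := by omega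
  rw [Finset.card_product, Finset.card_product, Int.card_Icc, Int.card_Icc, h0, h1,
    Finset.card_univ, Fintype.card_fin]

/-- Faces with cell coordinates within `5` of the site `c` belong to the face box about `c`.
[folklore] -/
theorem mem_faceBox {F : HexVertex} {c : Site 2} (h0 : |F.1 0 - c 0| ≤ 5) (h1 : |F.1 1 - c 1| ≤ 5) :
    F ∈ ((Finset.Icc (c 0 - 5) (c 0 + 5) ×ˢ Finset.Icc (c 1 - 5) (c 1 + 5)) ×ˢ
      (Finset.univ : Finset (Fin 2))).image
        (fun q : (ℤ × ℤ) × Fin 2 => (((![q.1.1, q.1.2] : Site 2), q.2) : HexVertex)) := by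
  rw [Finset.mem_image]
  refine ⟨((F.1 0, F.1 1), F.2), ?_, ?_⟩
  · rw [abs_le] at h0 h1
    simp only [Finset.mem_product, Finset.mem_Icc, Finset.mem_univ, and_true]
    omega
  · obtain ⟨y, t⟩ := F
    refine Prod.ext ?_ rfl
    ext j
    fin_cases j <;> rfl

/-! ### The short-distance cutoff -/

/-- **No self-avoiding walk traverses a shell many times near a controlled set of vertices**:
if every vertex of the path `w` followed by an adjacent vertex with embedded segment meeting
`B̄(x, ρ)` lies in the finite set `Q`, then the polyline of `w` does not traverse `D(x; ρ, R)`
(`ρ < R`) by `2 (#Q + 1) + 1` separate segments: its times in `B̄(x, ρ)` are covered by `#Q + 1`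
order-connected pieces (`hasOrdConnectedCover_preimage_polylineFrom`,
`segMeetCount_map_le_card_of_chain`, no vertex is repeated along a path), and
`le_of_hasTraversals_of_hasOrdConnectedCover` applies. (AB99 §1.a "short-distance cutoff",
quantitative lattice form; vertex-set variant of `not_hasTraversals_toCurve_of_isPath_of_subset` of
`Theorems/SAWRenewalTightnessTightOfShellCrossing.lean`.) [cite: AizenmanBurchardDuke1999, §1.a] -/
theorem not_hasTraversals_toCurve_of_isPath {V : Type*} {G : SimpleGraph V} {u v : V}
    {w : G.Walk u v} (hw : w.IsPath) (emb : V → ℂ) {x : ℂ} {ρ R : ℝ} (hρR : ρ < R)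
    (Q : Finset V)
    (hQ : ∀ p ∈ w.support, ∀ q, G.Adj p q →
      (segment ℝ (emb p) (emb q) ∩ closedBall x ρ).Nonempty → p ∈ Q) :
    ¬ (⟨w.toCurve emb⟩ : Curve ℂ).HasTraversals (2 * (Q.card + 1) + 1) x ρ R := by
  -- adapted from `not_hasTraversals_toCurve_of_isPath_of_subset`
  -- (Theorems/SAWRenewalTightnessTightOfShellCrossing)
  classical
  intro htr
  obtain ⟨l, hl⟩ : ∃ l, w.support = u :: l := ⟨w.support.tail, w.cons_tail_support.symm⟩
  have hfun : ∀ t, (⟨w.toCurve emb⟩ : Curve ℂ) t = (polylineFrom (emb u) (l.map emb)).2 t := by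
    intro t
    change polyline (w.support.map emb) t = _
    rw [hl]
    rfl
  have hcov := hasOrdConnectedCover_preimage_polylineFrom (convex_closedBall x ρ) (emb u)
    (l.map emb)
  have hpre : (⟨w.toCurve emb⟩ : Curve ℂ) ⁻¹' closedBall x ρ =
      (polylineFrom (emb u) (l.map emb)).2 ⁻¹' closedBall x ρ := by
    ext t
    rw [mem_preimage, mem_preimage, hfun]
  rw [← hpre] at hcov
  have hchain : List.IsChain G.Adj (u :: l) := hl ▸ w.isChain_adj_support
  have hnd : (u :: l).Nodup := hl ▸ hw.support_nodup
  have hcount : segMeetCount (closedBall x ρ) (emb u) (l.map emb) ≤ Q.card :=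
    segMeetCount_map_le_card_of_chain (closedBall x ρ) emb G.Adj u l hchain hnd Q
      fun p hp q hpq hmeet => hQ p (by rw [hl]; exact hp) q hpq hmeet
  have hle := le_of_hasTraversals_of_hasOrdConnectedCover hρR
    (hcov.mono (Nat.add_le_add_right hcount 1)) htr
  omega

/-- **(H0): the short-distance cutoff for self-avoiding honeycomb polylines.** At mesh `δ > 0`,
the polyline of a SAW of `Ω_δ ⊆ δℍ` traverses no shell `D(x; ρ, R)` with `ρ ≤ δ`, `ρ < R`, by
`487 = 2 · (242 + 1) + 1` separate segments: an edge of the walk whose rescaled segment meets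
`B̄(x, ρ)` starts within `ρ + δ/√3 ≤ 2δ` of `x`; all such start vertices have centres within `4`
(lattice units) of any one of them, hence lie in its face box (`≤ 242` faces); and a path visits
each vertex once (`not_hasTraversals_toCurve_of_isPath`). (AB99 §1.a: the lattice short-distance
cutoff.) [cite: AizenmanBurchardDuke1999, §1.a] -/
theorem not_hasTraversals_hexPolyline {Ω : Set ℂ} {δ : ℝ} (hδ : 0 < δ) {a b : HexVertex}
    (γ : HexDomainSAW Ω δ a b) {x : ℂ} {ρ R : ℝ} (hρδ : ρ ≤ δ) (hρR : ρ < R) :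
    ¬ (hexPolyline γ).HasTraversals (2 * (242 + 1) + 1) x ρ R := by
  set f : HexVertex → ℂ := fun v => (δ : ℂ) * hexCenter v with hf
  -- rescaled distances are `δ` times lattice distances
  have hdist : ∀ p q : HexVertex, dist (f p) (f q) = δ * dist (hexCenter p) (hexCenter q) := by
    intro p q
    simp only [hf, dist_eq_norm, ← mul_sub, norm_mul, Complex.norm_real, Real.norm_of_nonneg hδ.le]
  -- the start of an edge whose rescaled segment meets the small ball is within `2δ` of `x`
  have hnear : ∀ p q : HexVertex, (hexDomainGraph Ω δ).Adj p q →
      (segment ℝ (f p) (f q) ∩ closedBall x ρ).Nonempty → dist (f p) x ≤ 2 * δ := by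
    rintro p q hpq ⟨z, hzseg, hzball⟩
    have hadj : hexGraph.Adj p q := embDomainGraph_le _ _ _ _ hpq
    have hd : dist (f p) (f q) ≤ δ := by
      rw [hdist]
      exact mul_le_of_le_one_right hδ.le (dist_hexCenter_le_one_of_adj hadj)
    have h1 : dist (f p) z ≤ δ := by
      have := dist_add_dist_of_mem_segment hzseg
      linarith [dist_nonneg (x := z) (y := f q)]
    rw [mem_closedBall] at hzball
    linarith [dist_triangle (f p) z x]
  intro htr
  by_cases hex : ∃ F₀ : HexVertex, dist (f F₀) x ≤ 2 * δ
  · -- all relevant start vertices lie in the face box about the cell of `F₀`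
    obtain ⟨F₀, hF₀⟩ := hex
    set box : Finset HexVertex :=
      ((Finset.Icc (F₀.1 0 - 5) (F₀.1 0 + 5) ×ˢ Finset.Icc (F₀.1 1 - 5) (F₀.1 1 + 5)) ×ˢ
        (Finset.univ : Finset (Fin 2))).image
          (fun q : (ℤ × ℤ) × Fin 2 => (((![q.1.1, q.1.2] : Site 2), q.2) : HexVertex)) with hbox
    have hk : 2 * (box.card + 1) + 1 ≤ 2 * (242 + 1) + 1 := by
      have : box.card ≤ 242 := card_faceBox_le F₀.1
      omega
    refine not_hasTraversals_toCurve_of_isPath γ.isPath f hρR box (fun p _ q hpq hmeet => ?_)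
      (htr.of_le hk)
    have h4 : dist (f p) (f F₀) ≤ 4 * δ := by
      linarith [hnear p q hpq hmeet, dist_triangle (f p) x (f F₀), dist_comm x (f F₀)]
    rw [hdist, dist_eq_norm] at h4
    obtain ⟨h0, h1⟩ := abs_sub_le_of_norm_hexCenter_sub_le (F := p) (G := F₀) (by nlinarith)
    exact mem_faceBox h0 h1
  · -- no edge meets the small ball at all
    refine not_hasTraversals_toCurve_of_isPath γ.isPath f hρR ∅ (fun p _ q hpq hmeet => ?_)
      (htr.of_le (by simp))
    exact absurd ⟨p, hnear p q hpq hmeet⟩ hex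

end Tight

open Tight in
/-- **Stub 5 of the line `marginal-reflex-wedge-cauchy-kernel`: `HexTraversalBound → HexTight`.**
The Aizenman–Burchard multi-traversal bound for the critical hexagonal SAW law (for every Dobrushin
domain and endpoint approximation: a threshold `k x ρ R`, constants `K ≥ 0`, `λ > 2`, `δ₀ > 0` with
`P_δ(hexPolyline traverses D(x; ρ, R) k-fold) ≤ K (ρ/R)^λ` for `δ ∈ (0, δ₀]`, `δ ≤ ρ < R ≤ 1`)
implies eventual tightness of `δ ↦ hexSAWLaw` pushed to `CurveClass ℂ` (the route item `HexTight`),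
by the PROVED criterion `isTightMeasureSet_of_traversalBounds` (AB99 Thms 1.1–1.2) with a closed disc
containing `D` and the heads `δ c_{a δ}` as compact container (`d = 2`,
`exists_finset_card_le_cover_closedBall`), the SAW polylines `hexPolyline` as random curves
(classes `γ.curve`, `mk_hexPolyline`), `T = (0, δ₁]`, threshold `max 487 k`,
(H0) = `range_toCurve_subset_of_convex` + `not_hasTraversals_hexPolyline`, (H1) = the hypothesis,
and the bridge `isTightAlongMesh_of_isTightMeasureSet_image`.
[cite: AizenmanBurchardDuke1999, Thms 1.1-1.2 and §1.a] -/
theorem stub_hexTight_of_traversalBound : (∀ (D : DobrushinDomain) (a b : ℝ → HexVertex), IsEmbEndpointApprox hexGraph hexCenter D a b → ∃ (k : ℂ → ℝ → ℝ → ℕ) (K lam δ₀ : ℝ), 0 ≤ K ∧ 2 < lam ∧ 0 < δ₀ ∧ ∀ δ ∈ Set.Ioc (0 : ℝ) δ₀, ∀ (x : ℂ) (ρ R : ℝ), δ ≤ ρ → ρ < R → R ≤ 1 → hexSAWLaw D.carrier δ (a δ) (b δ) {γ | (hexPolyline γ).HasTraversals (k x ρ R) x ρ R} ≤ ENNReal.ofReal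 (K * (ρ / R) ^ lam)) → Summit.CriticalPhenomena.SAWScalingLimit.Theses.SAWDevelopingMap.HexTight := by
  intro hTB D a b hab
  -- the data of the traversal bound
  obtain ⟨k, K, lam, δ₀, hK, hlam, hδ₀, hbound⟩ := hTB D a b hab
  -- the head `δ c_{a δ}` is within `1` of the marked point `a` for small `δ`
  have hnear : ∀ᶠ δ : ℝ in 𝓝[>] (0 : ℝ), (δ : ℂ) * hexCenter (a δ) ∈ ball (D.pt 0) 1 :=
    hab.tendsto_fst.eventually_mem (ball_mem_nhds _ one_pos)
  obtain ⟨δ₂, hδ₂, hsub₂⟩ := mem_nhdsGT_iff_exists_Ioo_subset.1 hnear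
  have hδ₂' : (0 : ℝ) < δ₂ := hδ₂
  -- a disc containing the domain and the unit disc about `a`
  obtain ⟨r, hr⟩ := D.isBounded.subset_closedBall (0 : ℂ)
  set rΛ : ℝ := max r 0 + ‖D.pt 0‖ + 1 with hrΛ
  have hrΛ0 : 0 ≤ rΛ := by rw [hrΛ]; positivity
  have hΩ : D.carrier ⊆ closedBall (0 : ℂ) rΛ := hr.trans (closedBall_subset_closedBall (by
    rw [hrΛ]; linarith [le_max_left r 0, norm_nonneg (D.pt 0)]))
  have hball : ball (D.pt 0) 1 ⊆ closedBall (0 : ℂ) rΛ := by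
    intro z hz
    rw [mem_ball] at hz
    rw [mem_closedBall, dist_zero_right]
    have := norm_le_norm_add_norm_sub' z (D.pt 0)
    rw [← dist_eq_norm] at this
    rw [hrΛ]
    linarith [le_max_right r 0]
  -- the mesh threshold
  set δ₁ : ℝ := min (min δ₀ (δ₂ / 2)) 1 with hδ₁
  have hδ₁pos : 0 < δ₁ := lt_min (lt_min hδ₀ (half_pos hδ₂')) one_pos
  have hδ₁1 : δ₁ ≤ 1 := min_le_right _ _
  have hδ₁δ₀ : δ₁ ≤ δ₀ := (min_le_left _ _).trans (min_le_left _ _)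
  have hδ₁δ₂ : δ₁ < δ₂ := ((min_le_left _ _).trans (min_le_right _ _)).trans_lt (half_lt_self hδ₂')
  -- the criterion
  have hmain := isTightMeasureSet_of_traversalBounds (E := ℂ) (isCompact_closedBall (0 : ℂ) rΛ)
    (C := 9 * (rΛ + 2) ^ 2) (d := 2) (by norm_num)
    (fun ρ hρ hρ1 ↦ exists_finset_card_le_cover_closedBall hrΛ0 ρ hρ hρ1)
    (Ω := fun δ ↦ HexDomainSAW D.carrier δ (a δ) (b δ))
    (fun δ ↦ hexSAWLaw D.carrier δ (a δ) (b δ))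
    (fun δ γ ↦ hexPolyline γ)
    (fun x ρ R ↦ max (2 * (242 + 1) + 1) (k x ρ R)) (K := K) (lam := lam)
    hK hlam (T := Set.Ioc 0 δ₁) (fun δ hδ ↦ ⟨hδ.1, hδ.2.trans hδ₁1⟩) ?_ ?_
  · exact isTightAlongMesh_of_isTightMeasureSet_image
      (Eventually.of_forall fun δ ↦ (EmbDomainSAW.measurable_of_top _).aemeasurable) hδ₁pos hmain
  · -- (H0): range in `Λ`, and the short-distance cutoff
    intro δ hδ
    have hδpos : 0 < δ := hδ.1
    refine Eventually.of_forall fun γ ↦ ⟨?_, fun x ρ R _ hρδ hρR htr ↦ ?_⟩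
    · change Set.range (γ.walk.toCurve fun v => (δ : ℂ) * hexCenter v) ⊆ closedBall 0 rΛ
      refine range_toCurve_subset_of_convex γ.walk (convex_closedBall 0 rΛ) fun p hp ↦ ?_
      rcases γ.walk.mem_support_iff.1 hp with rfl | hp
      · exact hball (hsub₂ ⟨hδpos, hδ.2.trans_lt hδ₁δ₂⟩)
      · exact hΩ (embMeshDomain_subset _ _ _ _ (mem_embMeshDomain_of_mem_support_tail γ.walk hp))
    · exact not_hasTraversals_hexPolyline hδpos γ hρδ hρR (htr.of_le (le_max_left _ _))
  · -- (H1): the traversal bound, weakened in the threshold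
    intro δ hδ x ρ R hδρ hρR hR1
    have hδ' : δ ∈ Set.Ioc 0 δ₀ := ⟨hδ.1, hδ.2.trans hδ₁δ₀⟩
    exact le_trans (measure_mono fun γ hγ ↦ Curve.HasTraversals.of_le hγ (le_max_right _ _))
      (hbound δ hδ' x ρ R hδρ hρR hR1)

end Summit.CriticalPhenomena.SAWScalingLimit.Theorems.HexConjecture.MarginalWedge

end
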